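import Literature.Barriers.CriticalPhenomena.PlaquetteWalkHoleRootInteriorNoKill
import HarnessLib

/-!
# Barrier catalogue (SAWScalingLimit): LAW L's INTERIOR RING — free wound witnesses avoiding each non-corner ring cell,
every position

Leaf of `PlaquetteWalkHoleRootInteriorNoKill` (the mids-shift transport `exists_wound_witness_shift`, reference frame
`w42 = (4, 2)`, hole `(3, 2)`, far cell `(2, 2)`). The hole's closed `5 × 5` ring has four corner cells (their interior
non-kill is `PlaquetteWalkHoleRootInteriorNoKill`) and twelve non-corner boundary cells; on a WALL each of these empties or
marks a route (`…ShutRow`, `…ShutRowEast`, `…PrefixWall`, `…WallPocket`, `…EastWall`). In the INTERIOR (the ring cell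
removed, its outer neighbours present) the lane's kit job j288612 finds free wound witnesses of every type avoiding each of
them — except the far cell's outer neighbour `farWW = (1, 2)`, whose removal closes a door of the far cell and makes the
vertex functional vanish identically wherever it sits (`PlaquetteWalkHoleRootFarCellLaw`). The landed witness blocks
already avoid most (cell, type) pairs (`interiorBlock*42`, `overBlock*42`, `underBlock*42`); this file supplies the
missing nineteen pairs with EIGHT explicit 20/22-arc walks (a greedy cover of the job's output), each certified by the
kernel at the reference position (class `B2a`, first side, freeness by `decide`; woundness by the odd eastern ray count)
and transported to EVERY face list containing a translate of its block (§2): under `w₂`-free `US2a` (avoids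
`(5,1), (5,2), (5,3)`); under `w₁`-free `US1a` (`(2,0), (3,0), (4,0)`), `US1b` (`(5,1), (5,2)`), `US1c` (`(1,1)`); over
`w₂`-free `ON2a` (`(2,4), (3,4), (4,4)`), `ON2b` (`(5,2), (5,3)`), `ON2c` (`(1,3)`); over `w₁`-free `ON1a`
(`(5,1), (5,2), (5,3)`). With them «no interior ring cell other than `farWW` kills a route» is a bookkeeping corollary
for every box with the hole at least three cells from every wall (§3 gives the route-level non-kill statements; the box
assembly is left to the successor, DESIGN-next-g26 §2 (i)).

Not in print; venture lane «pcv-sawmu», seat b-step0 gen 26.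

References: A. Glazman, I. Manolescu, arXiv:1708.00395v3, §1 (Fig. 1, Fig. 2), §2.1, §4.2 (translation invariance) and
Lemma 2.1 [GlazmanManolescu2019]; A. Glazman, Electron. Commun. Probab. 20 (2015) no. 86, Lemma 3.1, proof pp. 6–7
[Glazman2015WeightedSAW]; R. Courant, H. Robbins, *What is Mathematics?* (1941/1958), Ch. V Appendix §2 (the even–odd
rule) [CourantRobbins1958].
-/

noncomputable section

open Set Function Complex

namespace Literature.Barriers.CriticalPhenomena.PlaquetteWalk

open Literature.Probability.RandomPlanarGeometry.SAW.YangBaxter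
open Real Complex

/-! ## §1–§2 The eight ring witnesses: reference position, certificates, every position -/

section Ring

/-- Ring witness block `US2a`: the 22 cells of an under w₂-free wound witness (reference root `(4, 2)`, hole
`(3, 2)`, far cell `(2, 2)`) AVOIDING the ring cell(s) `(5, 1)`, `(5, 2)`, `(5, 3)` (kit j288612 of the lane, block `[0,6]×[−1,5]`).
[cite: GlazmanManolescu2019, §2.1 (finite domains of faces)] -/
def ringBlockUS2a42 : List Face := [(1,0),(1,1),(1,2),(2,0),(2,1),(2,2),(2,3),(2,4),(3,0),(3,1),(3,4),(4,0),(4,1),(4,2),(4,4),(5,0),(5,4),(6,0),(6,1),(6,2),(6,3),(6,4)]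

/-- Its mid-edges (22 arcs). [cite: GlazmanManolescu2019, §1 (definition of the model), Fig. 1] -/
def ringUS2aMids : List MidEdge :=
  [.vert 4 2, .slant 4 2, .vert 4 1, .vert 3 1, .slant 2 2, .vert 2 2, .slant 1 2, .slant 1 1, .vert 2 0, .vert 3 0, .vert 4 0, .vert 5 0, .vert 6 0, .slant 6 1, .slant 6 2, .slant 6 3, .slant 6 4, .vert 6 4, .vert 5 4, .vert 4 4, .vert 3 4, .slant 2 4, .slant 2 3]

/-- The witness as a walk of its block. [cite: GlazmanManolescu2019, §1 (definition of the model), Fig. 1] -/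
def ringUS2aWalk : YBWalk (dom ringBlockUS2a42) (w42.side .W) ((farW w42).side .N) where
  mids := ringUS2aMids
  head_eq := by decide
  getLast_eq := by decide
  nodup := by decide
  arc_mem := arc_mem_of_check (by decide)
  isChain := by decide
  noncross := noncross_of_check (by decide)

/-- The labelled witness. [cite: Glazman2015WeightedSAW, Lemma 3.1 (proof, pp. 6–7)] -/
def ωringUS2a : ΩG (dom ringBlockUS2a42) (w42.side .W) (farW w42) := ⟨.N, ringUS2aWalk⟩

/-- Certificates: first hit `4`, `22` arcs, no later far-cell arc, first side `S`, w₂-free off the far cell, odd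
eastern-ray count (`1`). [cite: Glazman2015WeightedSAW, Lemma 3.1 (proof, pp. 6–7)] [cite: CourantRobbins1958, Ch. V Appendix §2 (the even–odd rule)] -/
theorem ωringUS2a_cert : ωringUS2a.2.firstHitG = 4 ∧ ωringUS2a.2.arcs.length = 22 ∧
    (∀ j < 22, 4 < j → ωringUS2a.2.fc j ≠ farW w42) ∧ ωringUS2a.2.nth 4 = (farW w42).side .S ∧
    ωringUS2a.2.W2FreeOff (farW w42) ∧
    Odd ((Finset.range 18).filter fun j => eastRayB w42 (ωringUS2a.2.nth (4 + j + 1)) = true).card := by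
  refine ⟨by decide, by decide, by decide, by decide, by unfold YBWalk.W2FreeOff; decide, by decide⟩

/-- The block at the root plaquette `w`. [cite: GlazmanManolescu2019, §2.1, §4.2 (translation invariance)] -/
def ringBlockUS2a (w : Face) : List Face := ringBlockUS2a42.map (Face.shiftBy (refShift w))

/-- ★★★ The under w₂-free wound witness `US2a` at EVERY POSITION: any face list containing the translated block
carries a wound class-`B2a` under-walk at the far cell, w₂-free off it. [cite: GlazmanManolescu2019, §4.2 (translation invariance), Lemma 2.1]
[cite: Glazman2015WeightedSAW, Lemma 3.1 (proof, pp. 6–7)] [cite: CourantRobbins1958, Ch. V Appendix §2 (the even–odd rule)] -/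
theorem exists_under_W2FreeOff_of_ringBlockUS2a {Dl : List Face} {w : Face} (hB : ∀ c ∈ ringBlockUS2a w, c ∈ Dl)
    (hr : RootedFace (dom Dl) (w.side .W) (farW w)) (θ : ℝ) :
    ∃ (ω : ΩG (dom Dl) (w.side .W) (farW w)) (h : ω.IsB2a), ω.2.firstSideG = .S ∧
      ω.WE (fun _ => θ) ≠ excursionWinding θ ω.2.firstSideG (ω.z1 hr h) ω.1 ∧ ω.2.W2FreeOff (farW w) := by
  have hB₀ := block42_mem_of_block_mem (B := ringBlockUS2a42) hB
  obtain ⟨hF, hn, hfc, hnth, hfree, hodd⟩ := ωringUS2a_cert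
  let ω₀ : ΩG (dom (Dl.map (Face.shiftBy (-refShift w)))) (w42.side .W) (farW w42) :=
    ⟨.N, ringUS2aWalk.mapDomain fun c hc => hB₀ c hc⟩
  have hF' : ω₀.2.firstHitG = 4 := hF
  have hn' : ω₀.2.arcs.length = 22 := hn
  have h₀ : ω₀.IsB2a := by
    refine ΩG.isB2a_of_forall_fc_ne (by rw [hF', hn']; omega) fun j hj1 hj2 => ?_
    rw [hF'] at hj1
    rw [hn'] at hj2
    exact hfc j hj2 hj1
  have hM : ω₀.Mv = 18 := by unfold ΩG.Mv; rw [hF', hn']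
  exact exists_wound_witness_shift (shiftBy_refShift_root w) (shiftBy_refShift_farW w) hr
    (fun γ r => γ.W2FreeOff r) (fun hm _ hf => YBWalk.W2FreeOff_of_mids_shift hm hf) ω₀ h₀
    (by rw [hF']; exact hnth) hfree (by rw [hM, hF']; exact hodd) θ

/-- Ring witness block `US1a`: the 19 cells of an under w₁-free wound witness (reference root `(4, 2)`, hole
`(3, 2)`, far cell `(2, 2)`) AVOIDING the ring cell(s) `(2, 0)`, `(3, 0)`, `(4, 0)` (kit j288612 of the lane, block `[0,6]×[−1,5]`).
[cite: GlazmanManolescu2019, §2.1 (finite domains of faces)] -/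
def ringBlockUS1a42 : List Face := [(1,-1),(1,0),(1,1),(1,2),(2,-1),(2,1),(2,2),(2,3),(3,-1),(3,1),(3,3),(4,-1),(4,1),(4,2),(4,3),(5,-1),(5,0),(5,1),(5,2)]

/-- Its mid-edges (20 arcs). [cite: GlazmanManolescu2019, §1 (definition of the model), Fig. 1] -/
def ringUS1aMids : List MidEdge :=
  [.vert 4 2, .slant 4 2, .vert 4 1, .vert 3 1, .slant 2 2, .vert 2 2, .slant 1 2, .slant 1 1, .slant 1 0, .vert 2 (-1), .vert 3 (-1), .vert 4 (-1), .vert 5 (-1), .slant 5 0, .slant 5 1, .slant 5 2, .vert 5 2, .slant 4 3, .vert 4 3, .vert 3 3, .slant 2 3]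

/-- The witness as a walk of its block. [cite: GlazmanManolescu2019, §1 (definition of the model), Fig. 1] -/
def ringUS1aWalk : YBWalk (dom ringBlockUS1a42) (w42.side .W) ((farW w42).side .N) where
  mids := ringUS1aMids
  head_eq := by decide
  getLast_eq := by decide
  nodup := by decide
  arc_mem := arc_mem_of_check (by decide)
  isChain := by decide
  noncross := noncross_of_check (by decide)

/-- The labelled witness. [cite: Glazman2015WeightedSAW, Lemma 3.1 (proof, pp. 6–7)] -/
def ωringUS1a : ΩG (dom ringBlockUS1a42) (w42.side .W) (farW w42) := ⟨.N, ringUS1aWalk⟩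

/-- Certificates: first hit `4`, `20` arcs, no later far-cell arc, first side `S`, w₁-free off the far cell, odd
eastern-ray count (`1`). [cite: Glazman2015WeightedSAW, Lemma 3.1 (proof, pp. 6–7)] [cite: CourantRobbins1958, Ch. V Appendix §2 (the even–odd rule)] -/
theorem ωringUS1a_cert : ωringUS1a.2.firstHitG = 4 ∧ ωringUS1a.2.arcs.length = 20 ∧
    (∀ j < 20, 4 < j → ωringUS1a.2.fc j ≠ farW w42) ∧ ωringUS1a.2.nth 4 = (farW w42).side .S ∧
    ωringUS1a.2.W1FreeOff (farW w42) ∧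
    Odd ((Finset.range 16).filter fun j => eastRayB w42 (ωringUS1a.2.nth (4 + j + 1)) = true).card := by
  refine ⟨by decide, by decide, by decide, by decide, by unfold YBWalk.W1FreeOff; decide, by decide⟩

/-- The block at the root plaquette `w`. [cite: GlazmanManolescu2019, §2.1, §4.2 (translation invariance)] -/
def ringBlockUS1a (w : Face) : List Face := ringBlockUS1a42.map (Face.shiftBy (refShift w))

/-- ★★★ The under w₁-free wound witness `US1a` at EVERY POSITION: any face list containing the translated block
carries a wound class-`B2a` under-walk at the far cell, w₁-free off it. [cite: GlazmanManolescu2019, §4.2 (translation invariance), Lemma 2.1]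
[cite: Glazman2015WeightedSAW, Lemma 3.1 (proof, pp. 6–7)] [cite: CourantRobbins1958, Ch. V Appendix §2 (the even–odd rule)] -/
theorem exists_under_W1FreeOff_of_ringBlockUS1a {Dl : List Face} {w : Face} (hB : ∀ c ∈ ringBlockUS1a w, c ∈ Dl)
    (hr : RootedFace (dom Dl) (w.side .W) (farW w)) (θ : ℝ) :
    ∃ (ω : ΩG (dom Dl) (w.side .W) (farW w)) (h : ω.IsB2a), ω.2.firstSideG = .S ∧
      ω.WE (fun _ => θ) ≠ excursionWinding θ ω.2.firstSideG (ω.z1 hr h) ω.1 ∧ ω.2.W1FreeOff (farW w) := by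
  have hB₀ := block42_mem_of_block_mem (B := ringBlockUS1a42) hB
  obtain ⟨hF, hn, hfc, hnth, hfree, hodd⟩ := ωringUS1a_cert
  let ω₀ : ΩG (dom (Dl.map (Face.shiftBy (-refShift w)))) (w42.side .W) (farW w42) :=
    ⟨.N, ringUS1aWalk.mapDomain fun c hc => hB₀ c hc⟩
  have hF' : ω₀.2.firstHitG = 4 := hF
  have hn' : ω₀.2.arcs.length = 20 := hn
  have h₀ : ω₀.IsB2a := by
    refine ΩG.isB2a_of_forall_fc_ne (by rw [hF', hn']; omega) fun j hj1 hj2 => ?_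
    rw [hF'] at hj1
    rw [hn'] at hj2
    exact hfc j hj2 hj1
  have hM : ω₀.Mv = 16 := by unfold ΩG.Mv; rw [hF', hn']
  exact exists_wound_witness_shift (shiftBy_refShift_root w) (shiftBy_refShift_farW w) hr
    (fun γ r => γ.W1FreeOff r) (fun hm _ hf => YBWalk.W1FreeOff_of_mids_shift hm hf) ω₀ h₀
    (by rw [hF']; exact hnth) hfree (by rw [hM, hF']; exact hodd) θ

/-- Ring witness block `US1b`: the 19 cells of an under w₁-free wound witness (reference root `(4, 2)`, hole
`(3, 2)`, far cell `(2, 2)`) AVOIDING the ring cell(s) `(5, 1)`, `(5, 2)` (kit j288612 of the lane, block `[0,6]×[−1,5]`).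
[cite: GlazmanManolescu2019, §2.1 (finite domains of faces)] -/
def ringBlockUS1b42 : List Face := [(1,1),(1,2),(2,0),(2,1),(2,2),(2,3),(3,0),(3,1),(3,3),(4,0),(4,1),(4,2),(4,3),(5,0),(5,3),(6,0),(6,1),(6,2),(6,3)]

/-- Its mid-edges (20 arcs). [cite: GlazmanManolescu2019, §1 (definition of the model), Fig. 1] -/
def ringUS1bMids : List MidEdge :=
  [.vert 4 2, .slant 4 2, .vert 4 1, .vert 3 1, .slant 2 2, .vert 2 2, .slant 1 2, .vert 2 1, .slant 2 1, .vert 3 0, .vert 4 0, .vert 5 0, .vert 6 0, .slant 6 1, .slant 6 2, .slant 6 3, .vert 6 3, .vert 5 3, .vert 4 3, .vert 3 3, .slant 2 3]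

/-- The witness as a walk of its block. [cite: GlazmanManolescu2019, §1 (definition of the model), Fig. 1] -/
def ringUS1bWalk : YBWalk (dom ringBlockUS1b42) (w42.side .W) ((farW w42).side .N) where
  mids := ringUS1bMids
  head_eq := by decide
  getLast_eq := by decide
  nodup := by decide
  arc_mem := arc_mem_of_check (by decide)
  isChain := by decide
  noncross := noncross_of_check (by decide)

/-- The labelled witness. [cite: Glazman2015WeightedSAW, Lemma 3.1 (proof, pp. 6–7)] -/
def ωringUS1b : ΩG (dom ringBlockUS1b42) (w42.side .W) (farW w42) := ⟨.N, ringUS1bWalk⟩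

/-- Certificates: first hit `4`, `20` arcs, no later far-cell arc, first side `S`, w₁-free off the far cell, odd
eastern-ray count (`1`). [cite: Glazman2015WeightedSAW, Lemma 3.1 (proof, pp. 6–7)] [cite: CourantRobbins1958, Ch. V Appendix §2 (the even–odd rule)] -/
theorem ωringUS1b_cert : ωringUS1b.2.firstHitG = 4 ∧ ωringUS1b.2.arcs.length = 20 ∧
    (∀ j < 20, 4 < j → ωringUS1b.2.fc j ≠ farW w42) ∧ ωringUS1b.2.nth 4 = (farW w42).side .S ∧
    ωringUS1b.2.W1FreeOff (farW w42) ∧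
    Odd ((Finset.range 16).filter fun j => eastRayB w42 (ωringUS1b.2.nth (4 + j + 1)) = true).card := by
  refine ⟨by decide, by decide, by decide, by decide, by unfold YBWalk.W1FreeOff; decide, by decide⟩

/-- The block at the root plaquette `w`. [cite: GlazmanManolescu2019, §2.1, §4.2 (translation invariance)] -/
def ringBlockUS1b (w : Face) : List Face := ringBlockUS1b42.map (Face.shiftBy (refShift w))

/-- ★★★ The under w₁-free wound witness `US1b` at EVERY POSITION: any face list containing the translated block
carries a wound class-`B2a` under-walk at the far cell, w₁-free off it. [cite: GlazmanManolescu2019, §4.2 (translation invariance), Lemma 2.1]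
[cite: Glazman2015WeightedSAW, Lemma 3.1 (proof, pp. 6–7)] [cite: CourantRobbins1958, Ch. V Appendix §2 (the even–odd rule)] -/
theorem exists_under_W1FreeOff_of_ringBlockUS1b {Dl : List Face} {w : Face} (hB : ∀ c ∈ ringBlockUS1b w, c ∈ Dl)
    (hr : RootedFace (dom Dl) (w.side .W) (farW w)) (θ : ℝ) :
    ∃ (ω : ΩG (dom Dl) (w.side .W) (farW w)) (h : ω.IsB2a), ω.2.firstSideG = .S ∧
      ω.WE (fun _ => θ) ≠ excursionWinding θ ω.2.firstSideG (ω.z1 hr h) ω.1 ∧ ω.2.W1FreeOff (farW w) := by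
  have hB₀ := block42_mem_of_block_mem (B := ringBlockUS1b42) hB
  obtain ⟨hF, hn, hfc, hnth, hfree, hodd⟩ := ωringUS1b_cert
  let ω₀ : ΩG (dom (Dl.map (Face.shiftBy (-refShift w)))) (w42.side .W) (farW w42) :=
    ⟨.N, ringUS1bWalk.mapDomain fun c hc => hB₀ c hc⟩
  have hF' : ω₀.2.firstHitG = 4 := hF
  have hn' : ω₀.2.arcs.length = 20 := hn
  have h₀ : ω₀.IsB2a := by
    refine ΩG.isB2a_of_forall_fc_ne (by rw [hF', hn']; omega) fun j hj1 hj2 => ?_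
    rw [hF'] at hj1
    rw [hn'] at hj2
    exact hfc j hj2 hj1
  have hM : ω₀.Mv = 16 := by unfold ΩG.Mv; rw [hF', hn']
  exact exists_wound_witness_shift (shiftBy_refShift_root w) (shiftBy_refShift_farW w) hr
    (fun γ r => γ.W1FreeOff r) (fun hm _ hf => YBWalk.W1FreeOff_of_mids_shift hm hf) ω₀ h₀
    (by rw [hF']; exact hnth) hfree (by rw [hM, hF']; exact hodd) θ

/-- Ring witness block `US1c`: the 19 cells of an under w₁-free wound witness (reference root `(4, 2)`, hole
`(3, 2)`, far cell `(2, 2)`) AVOIDING the ring cell(s) `(1, 1)` (kit j288612 of the lane, block `[0,6]×[−1,5]`).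
[cite: GlazmanManolescu2019, §2.1 (finite domains of faces)] -/
def ringBlockUS1c42 : List Face := [(0,0),(0,1),(0,2),(1,0),(1,2),(2,0),(2,1),(2,2),(2,3),(3,0),(3,1),(3,3),(4,0),(4,1),(4,2),(4,3),(5,0),(5,1),(5,2)]

/-- Its mid-edges (20 arcs). [cite: GlazmanManolescu2019, §1 (definition of the model), Fig. 1] -/
def ringUS1cMids : List MidEdge :=
  [.vert 4 2, .slant 4 2, .vert 4 1, .vert 3 1, .slant 2 2, .vert 2 2, .vert 1 2, .slant 0 2, .slant 0 1, .vert 1 0, .vert 2 0, .vert 3 0, .vert 4 0, .vert 5 0, .slant 5 1, .slant 5 2, .vert 5 2, .slant 4 3, .vert 4 3, .vert 3 3, .slant 2 3]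

/-- The witness as a walk of its block. [cite: GlazmanManolescu2019, §1 (definition of the model), Fig. 1] -/
def ringUS1cWalk : YBWalk (dom ringBlockUS1c42) (w42.side .W) ((farW w42).side .N) where
  mids := ringUS1cMids
  head_eq := by decide
  getLast_eq := by decide
  nodup := by decide
  arc_mem := arc_mem_of_check (by decide)
  isChain := by decide
  noncross := noncross_of_check (by decide)

/-- The labelled witness. [cite: Glazman2015WeightedSAW, Lemma 3.1 (proof, pp. 6–7)] -/
def ωringUS1c : ΩG (dom ringBlockUS1c42) (w42.side .W) (farW w42) := ⟨.N, ringUS1cWalk⟩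

/-- Certificates: first hit `4`, `20` arcs, no later far-cell arc, first side `S`, w₁-free off the far cell, odd
eastern-ray count (`1`). [cite: Glazman2015WeightedSAW, Lemma 3.1 (proof, pp. 6–7)] [cite: CourantRobbins1958, Ch. V Appendix §2 (the even–odd rule)] -/
theorem ωringUS1c_cert : ωringUS1c.2.firstHitG = 4 ∧ ωringUS1c.2.arcs.length = 20 ∧
    (∀ j < 20, 4 < j → ωringUS1c.2.fc j ≠ farW w42) ∧ ωringUS1c.2.nth 4 = (farW w42).side .S ∧
    ωringUS1c.2.W1FreeOff (farW w42) ∧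
    Odd ((Finset.range 16).filter fun j => eastRayB w42 (ωringUS1c.2.nth (4 + j + 1)) = true).card := by
  refine ⟨by decide, by decide, by decide, by decide, by unfold YBWalk.W1FreeOff; decide, by decide⟩

/-- The block at the root plaquette `w`. [cite: GlazmanManolescu2019, §2.1, §4.2 (translation invariance)] -/
def ringBlockUS1c (w : Face) : List Face := ringBlockUS1c42.map (Face.shiftBy (refShift w))

/-- ★★★ The under w₁-free wound witness `US1c` at EVERY POSITION: any face list containing the translated block
carries a wound class-`B2a` under-walk at the far cell, w₁-free off it. [cite: GlazmanManolescu2019, §4.2 (translation invariance), Lemma 2.1]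
[cite: Glazman2015WeightedSAW, Lemma 3.1 (proof, pp. 6–7)] [cite: CourantRobbins1958, Ch. V Appendix §2 (the even–odd rule)] -/
theorem exists_under_W1FreeOff_of_ringBlockUS1c {Dl : List Face} {w : Face} (hB : ∀ c ∈ ringBlockUS1c w, c ∈ Dl)
    (hr : RootedFace (dom Dl) (w.side .W) (farW w)) (θ : ℝ) :
    ∃ (ω : ΩG (dom Dl) (w.side .W) (farW w)) (h : ω.IsB2a), ω.2.firstSideG = .S ∧
      ω.WE (fun _ => θ) ≠ excursionWinding θ ω.2.firstSideG (ω.z1 hr h) ω.1 ∧ ω.2.W1FreeOff (farW w) := by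
  have hB₀ := block42_mem_of_block_mem (B := ringBlockUS1c42) hB
  obtain ⟨hF, hn, hfc, hnth, hfree, hodd⟩ := ωringUS1c_cert
  let ω₀ : ΩG (dom (Dl.map (Face.shiftBy (-refShift w)))) (w42.side .W) (farW w42) :=
    ⟨.N, ringUS1cWalk.mapDomain fun c hc => hB₀ c hc⟩
  have hF' : ω₀.2.firstHitG = 4 := hF
  have hn' : ω₀.2.arcs.length = 20 := hn
  have h₀ : ω₀.IsB2a := by
    refine ΩG.isB2a_of_forall_fc_ne (by rw [hF', hn']; omega) fun j hj1 hj2 => ?_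
    rw [hF'] at hj1
    rw [hn'] at hj2
    exact hfc j hj2 hj1
  have hM : ω₀.Mv = 16 := by unfold ΩG.Mv; rw [hF', hn']
  exact exists_wound_witness_shift (shiftBy_refShift_root w) (shiftBy_refShift_farW w) hr
    (fun γ r => γ.W1FreeOff r) (fun hm _ hf => YBWalk.W1FreeOff_of_mids_shift hm hf) ω₀ h₀
    (by rw [hF']; exact hnth) hfree (by rw [hM, hF']; exact hodd) θ

/-- Ring witness block `ON2a`: the 19 cells of an over w₂-free wound witness (reference root `(4, 2)`, hole
`(3, 2)`, far cell `(2, 2)`) AVOIDING the ring cell(s) `(2, 4)`, `(3, 4)`, `(4, 4)` (kit j288612 of the lane, block `[0,6]×[−1,5]`).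
[cite: GlazmanManolescu2019, §2.1 (finite domains of faces)] -/
def ringBlockON2a42 : List Face := [(1,2),(1,3),(1,4),(1,5),(2,1),(2,2),(2,3),(2,5),(3,1),(3,3),(3,5),(4,1),(4,2),(4,3),(4,5),(5,2),(5,3),(5,4),(5,5)]

/-- Its mid-edges (20 arcs). [cite: GlazmanManolescu2019, §1 (definition of the model), Fig. 1] -/
def ringON2aMids : List MidEdge :=
  [.vert 4 2, .slant 4 3, .vert 4 3, .vert 3 3, .slant 2 3, .vert 2 2, .slant 1 3, .slant 1 4, .slant 1 5, .vert 2 5, .vert 3 5, .vert 4 5, .vert 5 5, .slant 5 5, .slant 5 4, .slant 5 3, .vert 5 2, .slant 4 2, .vert 4 1, .vert 3 1, .slant 2 2]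

/-- The witness as a walk of its block. [cite: GlazmanManolescu2019, §1 (definition of the model), Fig. 1] -/
def ringON2aWalk : YBWalk (dom ringBlockON2a42) (w42.side .W) ((farW w42).side .S) where
  mids := ringON2aMids
  head_eq := by decide
  getLast_eq := by decide
  nodup := by decide
  arc_mem := arc_mem_of_check (by decide)
  isChain := by decide
  noncross := noncross_of_check (by decide)

/-- The labelled witness. [cite: Glazman2015WeightedSAW, Lemma 3.1 (proof, pp. 6–7)] -/
def ωringON2a : ΩG (dom ringBlockON2a42) (w42.side .W) (farW w42) := ⟨.S, ringON2aWalk⟩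

/-- Certificates: first hit `4`, `20` arcs, no later far-cell arc, first side `N`, w₂-free off the far cell, odd
eastern-ray count (`1`). [cite: Glazman2015WeightedSAW, Lemma 3.1 (proof, pp. 6–7)] [cite: CourantRobbins1958, Ch. V Appendix §2 (the even–odd rule)] -/
theorem ωringON2a_cert : ωringON2a.2.firstHitG = 4 ∧ ωringON2a.2.arcs.length = 20 ∧
    (∀ j < 20, 4 < j → ωringON2a.2.fc j ≠ farW w42) ∧ ωringON2a.2.nth 4 = (farW w42).side .N ∧
    ωringON2a.2.W2FreeOff (farW w42) ∧
    Odd ((Finset.range 16).filter fun j => eastRayB w42 (ωringON2a.2.nth (4 + j + 1)) = true).card := by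
  refine ⟨by decide, by decide, by decide, by decide, by unfold YBWalk.W2FreeOff; decide, by decide⟩

/-- The block at the root plaquette `w`. [cite: GlazmanManolescu2019, §2.1, §4.2 (translation invariance)] -/
def ringBlockON2a (w : Face) : List Face := ringBlockON2a42.map (Face.shiftBy (refShift w))

/-- ★★★ The over w₂-free wound witness `ON2a` at EVERY POSITION: any face list containing the translated block
carries a wound class-`B2a` over-walk at the far cell, w₂-free off it. [cite: GlazmanManolescu2019, §4.2 (translation invariance), Lemma 2.1]
[cite: Glazman2015WeightedSAW, Lemma 3.1 (proof, pp. 6–7)] [cite: CourantRobbins1958, Ch. V Appendix §2 (the even–odd rule)] -/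
theorem exists_over_W2FreeOff_of_ringBlockON2a {Dl : List Face} {w : Face} (hB : ∀ c ∈ ringBlockON2a w, c ∈ Dl)
    (hr : RootedFace (dom Dl) (w.side .W) (farW w)) (θ : ℝ) :
    ∃ (ω : ΩG (dom Dl) (w.side .W) (farW w)) (h : ω.IsB2a), ω.2.firstSideG = .N ∧
      ω.WE (fun _ => θ) ≠ excursionWinding θ ω.2.firstSideG (ω.z1 hr h) ω.1 ∧ ω.2.W2FreeOff (farW w) := by
  have hB₀ := block42_mem_of_block_mem (B := ringBlockON2a42) hB
  obtain ⟨hF, hn, hfc, hnth, hfree, hodd⟩ := ωringON2a_cert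
  let ω₀ : ΩG (dom (Dl.map (Face.shiftBy (-refShift w)))) (w42.side .W) (farW w42) :=
    ⟨.S, ringON2aWalk.mapDomain fun c hc => hB₀ c hc⟩
  have hF' : ω₀.2.firstHitG = 4 := hF
  have hn' : ω₀.2.arcs.length = 20 := hn
  have h₀ : ω₀.IsB2a := by
    refine ΩG.isB2a_of_forall_fc_ne (by rw [hF', hn']; omega) fun j hj1 hj2 => ?_
    rw [hF'] at hj1
    rw [hn'] at hj2
    exact hfc j hj2 hj1
  have hM : ω₀.Mv = 16 := by unfold ΩG.Mv; rw [hF', hn']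
  exact exists_wound_witness_shift (shiftBy_refShift_root w) (shiftBy_refShift_farW w) hr
    (fun γ r => γ.W2FreeOff r) (fun hm _ hf => YBWalk.W2FreeOff_of_mids_shift hm hf) ω₀ h₀
    (by rw [hF']; exact hnth) hfree (by rw [hM, hF']; exact hodd) θ

/-- Ring witness block `ON2b`: the 19 cells of an over w₂-free wound witness (reference root `(4, 2)`, hole
`(3, 2)`, far cell `(2, 2)`) AVOIDING the ring cell(s) `(5, 2)`, `(5, 3)` (kit j288612 of the lane, block `[0,6]×[−1,5]`).
[cite: GlazmanManolescu2019, §2.1 (finite domains of faces)] -/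
def ringBlockON2b42 : List Face := [(1,2),(1,3),(2,1),(2,2),(2,3),(2,4),(3,1),(3,3),(3,4),(4,1),(4,2),(4,3),(4,4),(5,1),(5,4),(6,1),(6,2),(6,3),(6,4)]

/-- Its mid-edges (20 arcs). [cite: GlazmanManolescu2019, §1 (definition of the model), Fig. 1] -/
def ringON2bMids : List MidEdge :=
  [.vert 4 2, .slant 4 3, .vert 4 3, .vert 3 3, .slant 2 3, .vert 2 2, .slant 1 3, .vert 2 3, .slant 2 4, .vert 3 4, .vert 4 4, .vert 5 4, .vert 6 4, .slant 6 4, .slant 6 3, .slant 6 2, .vert 6 1, .vert 5 1, .vert 4 1, .vert 3 1, .slant 2 2]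

/-- The witness as a walk of its block. [cite: GlazmanManolescu2019, §1 (definition of the model), Fig. 1] -/
def ringON2bWalk : YBWalk (dom ringBlockON2b42) (w42.side .W) ((farW w42).side .S) where
  mids := ringON2bMids
  head_eq := by decide
  getLast_eq := by decide
  nodup := by decide
  arc_mem := arc_mem_of_check (by decide)
  isChain := by decide
  noncross := noncross_of_check (by decide)

/-- The labelled witness. [cite: Glazman2015WeightedSAW, Lemma 3.1 (proof, pp. 6–7)] -/
def ωringON2b : ΩG (dom ringBlockON2b42) (w42.side .W) (farW w42) := ⟨.S, ringON2bWalk⟩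

/-- Certificates: first hit `4`, `20` arcs, no later far-cell arc, first side `N`, w₂-free off the far cell, odd
eastern-ray count (`1`). [cite: Glazman2015WeightedSAW, Lemma 3.1 (proof, pp. 6–7)] [cite: CourantRobbins1958, Ch. V Appendix §2 (the even–odd rule)] -/
theorem ωringON2b_cert : ωringON2b.2.firstHitG = 4 ∧ ωringON2b.2.arcs.length = 20 ∧
    (∀ j < 20, 4 < j → ωringON2b.2.fc j ≠ farW w42) ∧ ωringON2b.2.nth 4 = (farW w42).side .N ∧
    ωringON2b.2.W2FreeOff (farW w42) ∧
    Odd ((Finset.range 16).filter fun j => eastRayB w42 (ωringON2b.2.nth (4 + j + 1)) = true).card := by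
  refine ⟨by decide, by decide, by decide, by decide, by unfold YBWalk.W2FreeOff; decide, by decide⟩

/-- The block at the root plaquette `w`. [cite: GlazmanManolescu2019, §2.1, §4.2 (translation invariance)] -/
def ringBlockON2b (w : Face) : List Face := ringBlockON2b42.map (Face.shiftBy (refShift w))

/-- ★★★ The over w₂-free wound witness `ON2b` at EVERY POSITION: any face list containing the translated block
carries a wound class-`B2a` over-walk at the far cell, w₂-free off it. [cite: GlazmanManolescu2019, §4.2 (translation invariance), Lemma 2.1]
[cite: Glazman2015WeightedSAW, Lemma 3.1 (proof, pp. 6–7)] [cite: CourantRobbins1958, Ch. V Appendix §2 (the even–odd rule)] -/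
theorem exists_over_W2FreeOff_of_ringBlockON2b {Dl : List Face} {w : Face} (hB : ∀ c ∈ ringBlockON2b w, c ∈ Dl)
    (hr : RootedFace (dom Dl) (w.side .W) (farW w)) (θ : ℝ) :
    ∃ (ω : ΩG (dom Dl) (w.side .W) (farW w)) (h : ω.IsB2a), ω.2.firstSideG = .N ∧
      ω.WE (fun _ => θ) ≠ excursionWinding θ ω.2.firstSideG (ω.z1 hr h) ω.1 ∧ ω.2.W2FreeOff (farW w) := by
  have hB₀ := block42_mem_of_block_mem (B := ringBlockON2b42) hB
  obtain ⟨hF, hn, hfc, hnth, hfree, hodd⟩ := ωringON2b_cert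
  let ω₀ : ΩG (dom (Dl.map (Face.shiftBy (-refShift w)))) (w42.side .W) (farW w42) :=
    ⟨.S, ringON2bWalk.mapDomain fun c hc => hB₀ c hc⟩
  have hF' : ω₀.2.firstHitG = 4 := hF
  have hn' : ω₀.2.arcs.length = 20 := hn
  have h₀ : ω₀.IsB2a := by
    refine ΩG.isB2a_of_forall_fc_ne (by rw [hF', hn']; omega) fun j hj1 hj2 => ?_
    rw [hF'] at hj1
    rw [hn'] at hj2
    exact hfc j hj2 hj1
  have hM : ω₀.Mv = 16 := by unfold ΩG.Mv; rw [hF', hn']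
  exact exists_wound_witness_shift (shiftBy_refShift_root w) (shiftBy_refShift_farW w) hr
    (fun γ r => γ.W2FreeOff r) (fun hm _ hf => YBWalk.W2FreeOff_of_mids_shift hm hf) ω₀ h₀
    (by rw [hF']; exact hnth) hfree (by rw [hM, hF']; exact hodd) θ

/-- Ring witness block `ON2c`: the 19 cells of an over w₂-free wound witness (reference root `(4, 2)`, hole
`(3, 2)`, far cell `(2, 2)`) AVOIDING the ring cell(s) `(1, 3)` (kit j288612 of the lane, block `[0,6]×[−1,5]`).
[cite: GlazmanManolescu2019, §2.1 (finite domains of faces)] -/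
def ringBlockON2c42 : List Face := [(0,2),(0,3),(0,4),(1,2),(1,4),(2,1),(2,2),(2,3),(2,4),(3,1),(3,3),(3,4),(4,1),(4,2),(4,3),(4,4),(5,2),(5,3),(5,4)]

/-- Its mid-edges (20 arcs). [cite: GlazmanManolescu2019, §1 (definition of the model), Fig. 1] -/
def ringON2cMids : List MidEdge :=
  [.vert 4 2, .slant 4 3, .vert 4 3, .vert 3 3, .slant 2 3, .vert 2 2, .vert 1 2, .slant 0 3, .slant 0 4, .vert 1 4, .vert 2 4, .vert 3 4, .vert 4 4, .vert 5 4, .slant 5 4, .slant 5 3, .vert 5 2, .slant 4 2, .vert 4 1, .vert 3 1, .slant 2 2]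

/-- The witness as a walk of its block. [cite: GlazmanManolescu2019, §1 (definition of the model), Fig. 1] -/
def ringON2cWalk : YBWalk (dom ringBlockON2c42) (w42.side .W) ((farW w42).side .S) where
  mids := ringON2cMids
  head_eq := by decide
  getLast_eq := by decide
  nodup := by decide
  arc_mem := arc_mem_of_check (by decide)
  isChain := by decide
  noncross := noncross_of_check (by decide)

/-- The labelled witness. [cite: Glazman2015WeightedSAW, Lemma 3.1 (proof, pp. 6–7)] -/
def ωringON2c : ΩG (dom ringBlockON2c42) (w42.side .W) (farW w42) := ⟨.S, ringON2cWalk⟩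

/-- Certificates: first hit `4`, `20` arcs, no later far-cell arc, first side `N`, w₂-free off the far cell, odd
eastern-ray count (`1`). [cite: Glazman2015WeightedSAW, Lemma 3.1 (proof, pp. 6–7)] [cite: CourantRobbins1958, Ch. V Appendix §2 (the even–odd rule)] -/
theorem ωringON2c_cert : ωringON2c.2.firstHitG = 4 ∧ ωringON2c.2.arcs.length = 20 ∧
    (∀ j < 20, 4 < j → ωringON2c.2.fc j ≠ farW w42) ∧ ωringON2c.2.nth 4 = (farW w42).side .N ∧
    ωringON2c.2.W2FreeOff (farW w42) ∧
    Odd ((Finset.range 16).filter fun j => eastRayB w42 (ωringON2c.2.nth (4 + j + 1)) = true).card := by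
  refine ⟨by decide, by decide, by decide, by decide, by unfold YBWalk.W2FreeOff; decide, by decide⟩

/-- The block at the root plaquette `w`. [cite: GlazmanManolescu2019, §2.1, §4.2 (translation invariance)] -/
def ringBlockON2c (w : Face) : List Face := ringBlockON2c42.map (Face.shiftBy (refShift w))

/-- ★★★ The over w₂-free wound witness `ON2c` at EVERY POSITION: any face list containing the translated block
carries a wound class-`B2a` over-walk at the far cell, w₂-free off it. [cite: GlazmanManolescu2019, §4.2 (translation invariance), Lemma 2.1]
[cite: Glazman2015WeightedSAW, Lemma 3.1 (proof, pp. 6–7)] [cite: CourantRobbins1958, Ch. V Appendix §2 (the even–odd rule)] -/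
theorem exists_over_W2FreeOff_of_ringBlockON2c {Dl : List Face} {w : Face} (hB : ∀ c ∈ ringBlockON2c w, c ∈ Dl)
    (hr : RootedFace (dom Dl) (w.side .W) (farW w)) (θ : ℝ) :
    ∃ (ω : ΩG (dom Dl) (w.side .W) (farW w)) (h : ω.IsB2a), ω.2.firstSideG = .N ∧
      ω.WE (fun _ => θ) ≠ excursionWinding θ ω.2.firstSideG (ω.z1 hr h) ω.1 ∧ ω.2.W2FreeOff (farW w) := by
  have hB₀ := block42_mem_of_block_mem (B := ringBlockON2c42) hB
  obtain ⟨hF, hn, hfc, hnth, hfree, hodd⟩ := ωringON2c_cert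
  let ω₀ : ΩG (dom (Dl.map (Face.shiftBy (-refShift w)))) (w42.side .W) (farW w42) :=
    ⟨.S, ringON2cWalk.mapDomain fun c hc => hB₀ c hc⟩
  have hF' : ω₀.2.firstHitG = 4 := hF
  have hn' : ω₀.2.arcs.length = 20 := hn
  have h₀ : ω₀.IsB2a := by
    refine ΩG.isB2a_of_forall_fc_ne (by rw [hF', hn']; omega) fun j hj1 hj2 => ?_
    rw [hF'] at hj1
    rw [hn'] at hj2
    exact hfc j hj2 hj1
  have hM : ω₀.Mv = 16 := by unfold ΩG.Mv; rw [hF', hn']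
  exact exists_wound_witness_shift (shiftBy_refShift_root w) (shiftBy_refShift_farW w) hr
    (fun γ r => γ.W2FreeOff r) (fun hm _ hf => YBWalk.W2FreeOff_of_mids_shift hm hf) ω₀ h₀
    (by rw [hF']; exact hnth) hfree (by rw [hM, hF']; exact hodd) θ

/-- Ring witness block `ON1a`: the 22 cells of an over w₁-free wound witness (reference root `(4, 2)`, hole
`(3, 2)`, far cell `(2, 2)`) AVOIDING the ring cell(s) `(5, 1)`, `(5, 2)`, `(5, 3)` (kit j288612 of the lane, block `[0,6]×[−1,5]`).
[cite: GlazmanManolescu2019, §2.1 (finite domains of faces)] -/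
def ringBlockON1a42 : List Face := [(1,2),(1,3),(1,4),(2,0),(2,1),(2,2),(2,3),(2,4),(3,0),(3,3),(3,4),(4,0),(4,2),(4,3),(4,4),(5,0),(5,4),(6,0),(6,1),(6,2),(6,3),(6,4)]

/-- Its mid-edges (22 arcs). [cite: GlazmanManolescu2019, §1 (definition of the model), Fig. 1] -/
def ringON1aMids : List MidEdge :=
  [.vert 4 2, .slant 4 3, .vert 4 3, .vert 3 3, .slant 2 3, .vert 2 2, .slant 1 3, .slant 1 4, .vert 2 4, .vert 3 4, .vert 4 4, .vert 5 4, .vert 6 4, .slant 6 4, .slant 6 3, .slant 6 2, .slant 6 1, .vert 6 0, .vert 5 0, .vert 4 0, .vert 3 0, .slant 2 1, .slant 2 2]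

/-- The witness as a walk of its block. [cite: GlazmanManolescu2019, §1 (definition of the model), Fig. 1] -/
def ringON1aWalk : YBWalk (dom ringBlockON1a42) (w42.side .W) ((farW w42).side .S) where
  mids := ringON1aMids
  head_eq := by decide
  getLast_eq := by decide
  nodup := by decide
  arc_mem := arc_mem_of_check (by decide)
  isChain := by decide
  noncross := noncross_of_check (by decide)

/-- The labelled witness. [cite: Glazman2015WeightedSAW, Lemma 3.1 (proof, pp. 6–7)] -/
def ωringON1a : ΩG (dom ringBlockON1a42) (w42.side .W) (farW w42) := ⟨.S, ringON1aWalk⟩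

/-- Certificates: first hit `4`, `22` arcs, no later far-cell arc, first side `N`, w₁-free off the far cell, odd
eastern-ray count (`1`). [cite: Glazman2015WeightedSAW, Lemma 3.1 (proof, pp. 6–7)] [cite: CourantRobbins1958, Ch. V Appendix §2 (the even–odd rule)] -/
theorem ωringON1a_cert : ωringON1a.2.firstHitG = 4 ∧ ωringON1a.2.arcs.length = 22 ∧
    (∀ j < 22, 4 < j → ωringON1a.2.fc j ≠ farW w42) ∧ ωringON1a.2.nth 4 = (farW w42).side .N ∧
    ωringON1a.2.W1FreeOff (farW w42) ∧
    Odd ((Finset.range 18).filter fun j => eastRayB w42 (ωringON1a.2.nth (4 + j + 1)) = true).card := by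
  refine ⟨by decide, by decide, by decide, by decide, by unfold YBWalk.W1FreeOff; decide, by decide⟩

/-- The block at the root plaquette `w`. [cite: GlazmanManolescu2019, §2.1, §4.2 (translation invariance)] -/
def ringBlockON1a (w : Face) : List Face := ringBlockON1a42.map (Face.shiftBy (refShift w))

/-- ★★★ The over w₁-free wound witness `ON1a` at EVERY POSITION: any face list containing the translated block
carries a wound class-`B2a` over-walk at the far cell, w₁-free off it. [cite: GlazmanManolescu2019, §4.2 (translation invariance), Lemma 2.1]
[cite: Glazman2015WeightedSAW, Lemma 3.1 (proof, pp. 6–7)] [cite: CourantRobbins1958, Ch. V Appendix §2 (the even–odd rule)] -/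
theorem exists_over_W1FreeOff_of_ringBlockON1a {Dl : List Face} {w : Face} (hB : ∀ c ∈ ringBlockON1a w, c ∈ Dl)
    (hr : RootedFace (dom Dl) (w.side .W) (farW w)) (θ : ℝ) :
    ∃ (ω : ΩG (dom Dl) (w.side .W) (farW w)) (h : ω.IsB2a), ω.2.firstSideG = .N ∧
      ω.WE (fun _ => θ) ≠ excursionWinding θ ω.2.firstSideG (ω.z1 hr h) ω.1 ∧ ω.2.W1FreeOff (farW w) := by
  have hB₀ := block42_mem_of_block_mem (B := ringBlockON1a42) hB
  obtain ⟨hF, hn, hfc, hnth, hfree, hodd⟩ := ωringON1a_cert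
  let ω₀ : ΩG (dom (Dl.map (Face.shiftBy (-refShift w)))) (w42.side .W) (farW w42) :=
    ⟨.S, ringON1aWalk.mapDomain fun c hc => hB₀ c hc⟩
  have hF' : ω₀.2.firstHitG = 4 := hF
  have hn' : ω₀.2.arcs.length = 22 := hn
  have h₀ : ω₀.IsB2a := by
    refine ΩG.isB2a_of_forall_fc_ne (by rw [hF', hn']; omega) fun j hj1 hj2 => ?_
    rw [hF'] at hj1
    rw [hn'] at hj2
    exact hfc j hj2 hj1
  have hM : ω₀.Mv = 18 := by unfold ΩG.Mv; rw [hF', hn']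
  exact exists_wound_witness_shift (shiftBy_refShift_root w) (shiftBy_refShift_farW w) hr
    (fun γ r => γ.W1FreeOff r) (fun hm _ hf => YBWalk.W1FreeOff_of_mids_shift hm hf) ω₀ h₀
    (by rw [hF']; exact hnth) hfree (by rw [hM, hF']; exact hodd) θ


/-! ## §3 The route-level non-kill statements -/

variable {Dl : List Face} {w : Face}

/-- ★ With the block `ringBlockUS2a w` present the under route is NOT `w₂`-killed (a wound under-walk `w₂`-free off the
far cell exists) — in particular removing an INTERIOR eastern ring cell `(w.1 + 1, w.2)`, `(w.1 + 1, w.2 ∓ 1)` does not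
`w₂`-kill it. [cite: GlazmanManolescu2019, §1 (Fig. 2), Lemma 2.1] [cite: Glazman2015WeightedSAW, Lemma 3.1 (proof, pp. 6–7)] -/
theorem not_under_w2_killed_of_ringBlockUS2a (hB : ∀ c ∈ ringBlockUS2a w, c ∈ Dl)
    (hr : RootedFace (dom Dl) (w.side .W) (farW w)) (θ : ℝ) :
    ¬ ∀ (ω : ΩG (dom Dl) (w.side .W) (farW w)) (h : ω.IsB2a), ω.2.firstSideG = .S →
      ω.WE (fun _ => θ) ≠ excursionWinding θ ω.2.firstSideG (ω.z1 hr h) ω.1 → ¬ω.2.W2FreeOff (farW w) := by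
  intro hkill
  obtain ⟨ω, h, hS, hW, hfree⟩ := exists_under_W2FreeOff_of_ringBlockUS2a hB hr θ
  exact hkill ω h hS hW hfree

/-- ★ With any of the blocks `ringBlockUS1a/b/c w` present the under route is NOT `w₁`-killed.
[cite: GlazmanManolescu2019, §1 (remark after eq. (1)), Lemma 2.1] [cite: Glazman2015WeightedSAW, Lemma 3.1 (proof, pp. 6–7)] -/
theorem not_under_w1_killed_of_ringBlockUS1 (hB : (∀ c ∈ ringBlockUS1a w, c ∈ Dl) ∨ (∀ c ∈ ringBlockUS1b w, c ∈ Dl) ∨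
      ∀ c ∈ ringBlockUS1c w, c ∈ Dl)
    (hr : RootedFace (dom Dl) (w.side .W) (farW w)) (θ : ℝ) :
    ¬ ∀ (ω : ΩG (dom Dl) (w.side .W) (farW w)) (h : ω.IsB2a), ω.2.firstSideG = .S →
      ω.WE (fun _ => θ) ≠ excursionWinding θ ω.2.firstSideG (ω.z1 hr h) ω.1 → ¬ω.2.W1FreeOff (farW w) := by
  intro hkill
  rcases hB with hB | hB | hB
  · obtain ⟨ω, h, hS, hW, hfree⟩ := exists_under_W1FreeOff_of_ringBlockUS1a hB hr θ
    exact hkill ω h hS hW hfree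
  · obtain ⟨ω, h, hS, hW, hfree⟩ := exists_under_W1FreeOff_of_ringBlockUS1b hB hr θ
    exact hkill ω h hS hW hfree
  · obtain ⟨ω, h, hS, hW, hfree⟩ := exists_under_W1FreeOff_of_ringBlockUS1c hB hr θ
    exact hkill ω h hS hW hfree

/-- ★ With any of the blocks `ringBlockON2a/b/c w` present the over route is NOT `w₂`-killed.
[cite: GlazmanManolescu2019, §1 (Fig. 2), Lemma 2.1] [cite: Glazman2015WeightedSAW, Lemma 3.1 (proof, pp. 6–7)] -/
theorem not_over_w2_killed_of_ringBlockON2 (hB : (∀ c ∈ ringBlockON2a w, c ∈ Dl) ∨ (∀ c ∈ ringBlockON2b w, c ∈ Dl) ∨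
      ∀ c ∈ ringBlockON2c w, c ∈ Dl)
    (hr : RootedFace (dom Dl) (w.side .W) (farW w)) (θ : ℝ) :
    ¬ ∀ (ω : ΩG (dom Dl) (w.side .W) (farW w)) (h : ω.IsB2a), ω.2.firstSideG = .N →
      ω.WE (fun _ => θ) ≠ excursionWinding θ ω.2.firstSideG (ω.z1 hr h) ω.1 → ¬ω.2.W2FreeOff (farW w) := by
  intro hkill
  rcases hB with hB | hB | hB
  · obtain ⟨ω, h, hN, hW, hfree⟩ := exists_over_W2FreeOff_of_ringBlockON2a hB hr θ
    exact hkill ω h hN hW hfree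
  · obtain ⟨ω, h, hN, hW, hfree⟩ := exists_over_W2FreeOff_of_ringBlockON2b hB hr θ
    exact hkill ω h hN hW hfree
  · obtain ⟨ω, h, hN, hW, hfree⟩ := exists_over_W2FreeOff_of_ringBlockON2c hB hr θ
    exact hkill ω h hN hW hfree

/-- ★ With the block `ringBlockON1a w` present the over route is NOT `w₁`-killed.
[cite: GlazmanManolescu2019, §1 (remark after eq. (1)), Lemma 2.1] [cite: Glazman2015WeightedSAW, Lemma 3.1 (proof, pp. 6–7)] -/
theorem not_over_w1_killed_of_ringBlockON1a (hB : ∀ c ∈ ringBlockON1a w, c ∈ Dl)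
    (hr : RootedFace (dom Dl) (w.side .W) (farW w)) (θ : ℝ) :
    ¬ ∀ (ω : ΩG (dom Dl) (w.side .W) (farW w)) (h : ω.IsB2a), ω.2.firstSideG = .N →
      ω.WE (fun _ => θ) ≠ excursionWinding θ ω.2.firstSideG (ω.z1 hr h) ω.1 → ¬ω.2.W1FreeOff (farW w) := by
  intro hkill
  obtain ⟨ω, h, hN, hW, hfree⟩ := exists_over_W1FreeOff_of_ringBlockON1a hB hr θ
  exact hkill ω h hN hW hfree

end Ring

end Literature.Barriers.CriticalPhenomena.PlaquetteWalk
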